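import Literature.AlgebraicGeometry.Frobenioids.Cor54SubSquareCanonical
import Literature.AlgebraicGeometry.Frobenioids.BaseCategoryTheoreticityInstancesIstr
import Literature.AlgebraicGeometry.Frobenioids.CategoriesSquaresOneObjectWitness
import Mathlib.CategoryTheory.Localization.Adjunction
import HarnessLib

/-!
# Frobenioids I, Corollary 5.4: the PRINTED diagram — vertical arrows from `C_i`, rigid composites from
# the Div-slimness of `D_i`, at THE constructions

Mochizuki, *The geometry of Frobenioids I: the general theory*, Kyushu J. Math. **62** (2008) 293–400,
Cor. 5.4, kurims p. 103 l. 37 – p. 104 l. 9: "For `i = 1, 2`, let `Φ_i` be a perf-factorial divisorial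
monoid on a connected, totally epimorphic category `D_i` which is Div-slim [with respect to `Φ_i`];
`C_i → F_{Φ_i}` a Frobenioid of rationally standard type; `Ψ : C₁ ⥲ C₂` an equivalence of categories. If `C₁`,
`C₂` are of group-like type, then we also assume that both `Ψ` and some quasi-inverse to `Ψ` preserve
base-isomorphisms. Then there exists a 1-unique functor `Ψ^rlf : C₁^rlf → C₂^rlf` that fits into a
1-commutative diagram" (display: `C₁ → C₂` over `C₁^rlf → C₂^rlf`) "[where the vertical arrows are the natural
functors of Proposition 5.3; the horizontal arrows are equivalences of categories]. Moreover, each of the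
composite functors of this diagram is rigid."; proof p. 104 ll. 21–24: "Corollary 5.4 follows immediately
from Corollaries 4.10; 4.11, (iii), (iv). [Here, we note that the rigidity assertion of Corollary 5.4 follows
by a similar argument applied to prove the rigidity assertion in Corollary 4.11, (i), (iv).]"
[cite: MochizukiFrdI2008, Cor. 5.4 p.104]

PROOF-ONLY file (cell abc-iut, layer L1, seat abc-iut-L1-t10 gen 4, row «C54-AS-PRINTED KNIT», L1-lead
R128 (1); closes the clause-coverage notes INFO-2/3 of the audit of `Cor54SubSquareCanonical.lean`, seat
abc-iut-f-139).  The joint closer `FrdI.Cor54Sub.exists_rlfTransport_square'` (seat abc-iut-L1-t10 gen 3)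
delivers the square of Cor. 5.4 with THE vertical arrows `ι_i : C_i^istr → C_i^rlf` of Prop. 5.3
(`FrdI.Prop53Sub.iotaRlf`, seat abc-iut-w5-d137) and the rigidity clause `rigid_canonical` under Div-slimness
of THE REALIFIED operations.  Print's vertical arrows start at `C_i`: they are the composites
`C_i → C_i^istr → C_i^rlf` with the isotropification functors of Prop. 1.9 (v)
(`PreFrobenioid.isotropification`, seat abc-iut-L1-t1, read in the §3 full subcategory `(ofFunctor Φ F).Istr`
through `ObjectProperty.ιOfLE`, as in seat abc-iut-w4-d088's `PreFrobenioid.thm34i_istr_ofFunctor`), and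
print's hypothesis is Div-slimness of `D_i` with respect to `Φ_i`.  This file pastes:

* `IsRigidFunctor.leftAdjoint_comp` — precomposition with a REFLECTOR (a left adjoint whose right adjoint is
  fully faithful, e.g. `C → C^istr`, Prop. 1.9 (v)) preserves rigidity: a reflector is a localization
  (Mathlib `Adjunction.isLocalization`), so whiskering along it is fully faithful
  (`Localization.full_whiskeringLeft`) and seat abc-iut-w5-d222's `IsRigidFunctor.whiskeringLeft_comp` applies;
* `FrdI.Cor54Sub.nonempty_iso_restriction_of_restricts` — a functor `Ψ^istr : C₁^istr → C₂^istr` with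
  `Ψ^istr ⋙ (C₂^istr ⊆ C₂) ≅ (C₁^istr ⊆ C₁) ⋙ Ψ` (the binder `hΨistr` of the joint closer) IS, up to
  isomorphism, THE restriction `Ψ.congrFullSubcategory _` of the equivalence `Ψ` (Thm. 3.4 (i): `Ψ` preserves
  isotropic objects, `FrdI.isotropicObjects_ofFunctor_inverseImage`); hence it is an equivalence
  (`isEquivalence_of_restricts`) and fits the `1`-commutative square of Thm. 3.4 (i) with the isotropification
  functors (`oneCommutes_isotropification_of_restricts`, by seat abc-iut-w4-d088's
  `PreFrobenioid.nonempty_isotropification_comp_iso`: both composites are left adjoint to `C₂^istr → C₁`);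
* `FrdI.Cor54Sub.printedDiagram_of_restricts` — **Cor. 5.4 with print's vertical arrows and print's Div-slim
  hypothesis, modulo the Cor. 4.11 package** (the binders of `exists_rlfTransport_square'`: `Ψ^istr`, `Ψ^un-tr`
  with the square of Cor. 4.11 (i), `(Ψ^Base, Ψ^Φ = E, η, hdeg, hdiv)` of Cor. 4.11 (ii)–(iv), and the
  `Φ^birat`-compatibility of Cor. 4.10): THERE EXISTS `Ψ^rlf`, an equivalence induced by `(Ψ^Base, (Ψ^Φ)^rlf)`,
  with `Ψ ⋙ (C₂ → C₂^rlf) ≅ (C₁ → C₁^rlf) ⋙ Ψ^rlf`, BOTH composites `C₁ → C₂^rlf` RIGID as soon as `D₁`, `D₂` are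
  Div-slim with respect to `Φ₁`, `Φ₂` (seat abc-iut-L1-d2's `isDivSlim_ofFunctor_rlf` feeds seat abc-iut-w5-d222's
  `rigid_of`; then `leftAdjoint_comp` along `C₁ → C₁^istr`), and `1`-unique among the functors induced by the
  same data (honest form, row C54/L07);
* `FrdI.Cor54Sub.printedDiagram_of_preservesPreSteps` — the same with the `Φ^birat`-compatibility discharged from
  `Ψ`, `Ψ⁻¹` preserve pre-steps and co-angular pre-steps (conclusion shape of Thm. 3.4 (ii) "`Ψ` preserves
  pre-steps, co-angular pre-steps, and group-like objects"; seat abc-iut-w5-d221's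
  `biratCompat_of`);
* `FrdI.Cor54Sub.printedDiagram_restriction` — the same at THE `Ψ^istr :=` restriction of `Ψ` (no `Ψ^istr`
  binder: `hΨistr` is the identity).

Print's LAST clause ("the formation of `Ψ^rlf` from `Ψ` is 1-compatible with the 1-commutative diagram of
Proposition 5.3") is row C54/L09 (`compatProp53_of_square`, seat abc-iut-w5-d137) and is not repeated here.
No definition, no new notion, no statement of the paper restated or strengthened; [FrdI] is a refereed
prerequisite paper — nothing here bears on [IUTchIII] Cor. 3.12.
-/

namespace Literature.AlgebraicGeometry.Frobenioids

open CategoryTheory Opposite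

universe w v v' u u' v₁ u₁ v₂ u₂ v₃ u₃

/-! ### Rigid functors: precomposition with a reflector -/

section Rigid

variable {P : Type u₁} [Category.{v₁} P] {Q : Type u₂} [Category.{v₂} Q] {Z : Type u₃} [Category.{v₃} Z]

/-- Precomposing a rigid functor `G : Q → Z` with a REFLECTOR `L : P → Q` (a left adjoint whose right adjoint
is fully faithful — e.g. the isotropification functor `C → C^istr` of Prop. 1.9 (v), left adjoint to the
inclusion `C^istr ⊆ C`) yields a rigid functor: `L` is a localization functor (Mathlib
`Adjunction.isLocalization`), so whiskering `(Q ⥤ Z) → (P ⥤ Z)` along `L` is fully faithful and every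
automorphism of `L ⋙ G` comes from one of `G` (FrdI §0 p. 14 "rigid"). [cite: MochizukiFrdI2008, §0 p.14] -/
theorem IsRigidFunctor.leftAdjoint_comp {L : P ⥤ Q} {R : Q ⥤ P} (adj : L ⊣ R) [R.Full] [R.Faithful]
    {G : Q ⥤ Z} (hG : IsRigidFunctor G) : IsRigidFunctor (L ⋙ G) := by
  haveI := adj.isLocalization
  haveI := Localization.full_whiskeringLeft L ((MorphismProperty.isomorphisms Q).inverseImage L) Z
  haveI := Localization.faithful_whiskeringLeft L ((MorphismProperty.isomorphisms Q).inverseImage L) Z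
  exact IsRigidFunctor.whiskeringLeft_comp L hG

end Rigid

namespace FrdI.Cor54Sub

open PreFrobenioidData (ofFunctor)

variable {D₁ : Type u} [Category.{v} D₁] {Φ₁ : D₁ᵒᵖ ⥤ CommMonCat.{w}} {C₁ : Type u'} [Category.{v'} C₁]
  {D₂ : Type u} [Category.{v} D₂] {Φ₂ : D₂ᵒᵖ ⥤ CommMonCat.{w}} {C₂ : Type u'} [Category.{v'} C₂]
  {F₁ : C₁ ⥤ ElemFrobenioid Φ₁} {F₂ : C₂ ⥤ ElemFrobenioid Φ₂}

/-! ### A `Ψ^istr` restricting `Ψ` IS THE restriction: equivalence, and the square of Thm. 3.4 (i) -/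

/-- For Frobenioids of quasi-isotropic type and an equivalence `Ψ : C₁ ⥲ C₂`, every functor
`Ψ^istr : C₁^istr → C₂^istr` with `Ψ^istr ⋙ (C₂^istr ⊆ C₂) ≅ (C₁^istr ⊆ C₁) ⋙ Ψ` is isomorphic to THE restriction
`Ψ.congrFullSubcategory _` of `Ψ` to the isotropic objects (Thm. 3.4 (i): "`Ψ` preserves the isotropic
objects", `FrdI.isotropicObjects_ofFunctor_inverseImage`): two functors into `C₂^istr` with isomorphic
composites to `C₂` are isomorphic (`C₂^istr ⊆ C₂` is fully faithful). [cite: MochizukiFrdI2008, Thm. 3.4 (i) p.62] -/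
theorem nonempty_iso_restriction_of_restricts (hF₁ : PreFrobenioid.IsFrobenioid F₁)
    (hq₁ : (ofFunctor Φ₁ F₁).IsOfQuasiIsotropicType)
    (hq₂ : (ofFunctor Φ₂ F₂).IsOfQuasiIsotropicType) (Ψ : C₁ ≌ C₂)
    [(ofFunctor Φ₂ F₂).isotropicObjects.IsClosedUnderIsomorphisms]
    (Ψistr : (ofFunctor Φ₁ F₁).Istr ⥤ (ofFunctor Φ₂ F₂).Istr)
    (hΨistr : Ψistr ⋙ (ofFunctor Φ₂ F₂).istrι ≅ (ofFunctor Φ₁ F₁).istrι ⋙ Ψ.functor) :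
    Nonempty (Ψistr ≅ (Ψ.congrFullSubcategory (isotropicObjects_ofFunctor_inverseImage hF₁ hq₁ hq₂ Ψ)).functor) := by
  let G := Ψ.congrFullSubcategory (isotropicObjects_ofFunctor_inverseImage hF₁ hq₁ hq₂ Ψ)
  -- THE restriction lies over `Ψ` on the nose
  let hG : G.functor ⋙ (ofFunctor Φ₂ F₂).istrι ≅ (ofFunctor Φ₁ F₁).istrι ⋙ Ψ.functor := Iso.refl _
  exact ⟨Functor.fullyFaithfulCancelRight (ofFunctor Φ₂ F₂).istrι (hΨistr ≪≫ hG.symm)⟩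

/-- Hence such a `Ψ^istr` is an EQUIVALENCE `C₁^istr ⥲ C₂^istr` ("the horizontal arrows are equivalences of
categories", Thm. 3.4 (i) p. 62). [cite: MochizukiFrdI2008, Thm. 3.4 (i) p.62] -/
theorem isEquivalence_of_restricts (hF₁ : PreFrobenioid.IsFrobenioid F₁)
    (hF₂ : PreFrobenioid.IsFrobenioid F₂) (hq₁ : (ofFunctor Φ₁ F₁).IsOfQuasiIsotropicType)
    (hq₂ : (ofFunctor Φ₂ F₂).IsOfQuasiIsotropicType) (Ψ : C₁ ≌ C₂)
    (Ψistr : (ofFunctor Φ₁ F₁).Istr ⥤ (ofFunctor Φ₂ F₂).Istr)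
    (hΨistr : Ψistr ⋙ (ofFunctor Φ₂ F₂).istrι ≅ (ofFunctor Φ₁ F₁).istrι ⋙ Ψ.functor) :
    Ψistr.IsEquivalence := by
  haveI := isClosedUnderIsomorphisms_isotropicObjects_ofFunctor (Φ₂ := Φ₂) hF₂
  obtain ⟨e⟩ := nonempty_iso_restriction_of_restricts hF₁ hq₁ hq₂ Ψ Ψistr hΨistr
  exact Functor.isEquivalence_of_iso e.symm

/-- … and it fits the `1`-commutative square of Thm. 3.4 (i) with the isotropification functors
`C_i → C_i^istr` of Prop. 1.9 (v) (seat abc-iut-L1-t1's `PreFrobenioid.isotropification`, read in the §3 full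
subcategory through `ObjectProperty.ιOfLE`): `Ψ ⋙ (C₂ → C₂^istr) ≅ (C₁ → C₁^istr) ⋙ Ψ^istr` — for THE
restriction both composites are left adjoint to `C₂^istr → C₁` (seat abc-iut-w4-d088's
`PreFrobenioid.nonempty_isotropification_comp_iso`). [cite: MochizukiFrdI2008, Thm. 3.4 (i) p.62] -/
theorem oneCommutes_isotropification_of_restricts (hF₁ : PreFrobenioid.IsFrobenioid F₁)
    (hF₂ : PreFrobenioid.IsFrobenioid F₂) (hq₁ : (ofFunctor Φ₁ F₁).IsOfQuasiIsotropicType)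
    (hq₂ : (ofFunctor Φ₂ F₂).IsOfQuasiIsotropicType) (Ψ : C₁ ≌ C₂)
    (Ψistr : (ofFunctor Φ₁ F₁).Istr ⥤ (ofFunctor Φ₂ F₂).Istr)
    (hΨistr : Ψistr ⋙ (ofFunctor Φ₂ F₂).istrι ≅ (ofFunctor Φ₁ F₁).istrι ⋙ Ψ.functor) :
    OneCommutes Ψ.functor
      (PreFrobenioid.isotropification hF₂ ⋙ ObjectProperty.ιOfLE (PreFrobenioid.isotropicObjects_le_ofFunctor F₂))
      (PreFrobenioid.isotropification hF₁ ⋙ ObjectProperty.ιOfLE (PreFrobenioid.isotropicObjects_le_ofFunctor F₁))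
      Ψistr := by
  haveI : (PreFrobenioid.isotropicObjects F₂).IsClosedUnderIsomorphisms :=
    ⟨fun e hX => PreFrobenioid.IsIsotropic.of_iso hF₂.isPreFrobenioid e.symm hX⟩
  -- the identity-on-objects comparisons between the two renderings of `C_i^istr`
  let J₁ : PreFrobenioid.Istr F₁ ⥤ (ofFunctor Φ₁ F₁).Istr :=
    ObjectProperty.ιOfLE (PreFrobenioid.isotropicObjects_le_ofFunctor F₁)
  let J₂ : PreFrobenioid.Istr F₂ ⥤ (ofFunctor Φ₂ F₂).Istr :=
    ObjectProperty.ιOfLE (PreFrobenioid.isotropicObjects_le_ofFunctor F₂)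
  -- THE restriction of `Ψ` in seat abc-iut-L1-t1's rendering, and the core square of Thm. 3.4 (i)
  let G := Ψ.congrFullSubcategory (FrdI.isotropicObjects_inverseImage hF₁ hq₁ hq₂ Ψ)
  obtain ⟨core⟩ := PreFrobenioid.nonempty_isotropification_comp_iso hF₁ hF₂ hq₁ hq₂ Ψ
  -- `J₁ ⋙ Ψ^istr ≅ G ⋙ J₂`: both lie over `(C₁^istr ⊆ C₁) ⋙ Ψ` on composing with the fully faithful `C₂^istr ⊆ C₂`
  let h₁ : (J₁ ⋙ Ψistr) ⋙ (ofFunctor Φ₂ F₂).istrι ≅ (PreFrobenioid.isotropicObjects F₁).ι ⋙ Ψ.functor :=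
    Functor.associator _ _ _ ≪≫ Functor.isoWhiskerLeft J₁ hΨistr
  let h₂ : (G.functor ⋙ J₂) ⋙ (ofFunctor Φ₂ F₂).istrι ≅ (PreFrobenioid.isotropicObjects F₁).ι ⋙ Ψ.functor :=
    Iso.refl _
  let c : J₁ ⋙ Ψistr ≅ G.functor ⋙ J₂ :=
    Functor.fullyFaithfulCancelRight (ofFunctor Φ₂ F₂).istrι (h₁ ≪≫ h₂.symm)
  refine ⟨?_⟩
  calc Ψ.functor ⋙ PreFrobenioid.isotropification hF₂ ⋙ J₂
      ≅ (Ψ.functor ⋙ PreFrobenioid.isotropification hF₂) ⋙ J₂ := (Functor.associator _ _ _).symm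
    _ ≅ (PreFrobenioid.isotropification hF₁ ⋙ G.functor) ⋙ J₂ := Functor.isoWhiskerRight core.symm J₂
    _ ≅ PreFrobenioid.isotropification hF₁ ⋙ (G.functor ⋙ J₂) := Functor.associator _ _ _
    _ ≅ PreFrobenioid.isotropification hF₁ ⋙ (J₁ ⋙ Ψistr) :=
        Functor.isoWhiskerLeft (PreFrobenioid.isotropification hF₁) c.symm
    _ ≅ (PreFrobenioid.isotropification hF₁ ⋙ J₁) ⋙ Ψistr := (Functor.associator _ _ _).symm

/-! ### Corollary 5.4 with print's vertical arrows `C_i → C_i^istr → C_i^rlf` and print's Div-slim hypothesis -/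

variable (F₁ F₂) (hΦ₁ : PreFrobenioid.IsPerfFactorialOn Φ₁) (hΦ₂ : PreFrobenioid.IsPerfFactorialOn Φ₂)

/-- **[FrdI] Cor. 5.4, THE PRINTED DIAGRAM at THE constructions, modulo the Cor. 4.11 package.**  For
Frobenioids `C_i → F_{Φ_i}` of quasi-isotropic type over perf-factorial `Φ_i`, an EQUIVALENCE `Ψ : C₁ ⥲ C₂`, a
restriction `Ψ^istr` of `Ψ` to the isotropic objects, `Ψ^un-tr` with the square of Cor. 4.11 (i), the data
`(Ψ^Base, Ψ^Φ = E, η)` of Cor. 4.11 (ii)–(iv) with the degree and divisor compatibilities, and the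
`Φ^birat`-compatibility of `Ψ^Φ` (Cor. 4.10): THERE EXISTS `Ψ^rlf : C₁^rlf → C₂^rlf`, an EQUIVALENCE INDUCED by
`(Ψ^Base, (Ψ^Φ)^rlf)`, such that the square `Ψ ⋙ (C₂ → C₂^rlf) ≅ (C₁ → C₁^rlf) ⋙ Ψ^rlf` with print's vertical
arrows — the natural functors `C_i → C_i^istr → C_i^rlf` of Prop. 5.3 (isotropification of Prop. 1.9 (v)
followed by THE `ι_i = FrdI.Prop53Sub.iotaRlf F_i hΦ_i (untrComparison F_i hF_i)`) — `1`-COMMUTES; if `D₁`,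
`D₂` are Div-slim with respect to `Φ₁`, `Φ₂` (print's hypothesis, Def. 4.5 (iv)) then EACH COMPOSITE
`C₁ → C₂^rlf` of this diagram IS RIGID; and `Ψ^rlf` is `1`-unique among the functors induced by the same data
(honest form of "1-unique", row C54/L07).  Assembly of `exists_rlfTransport_square'` (rows C54/L05–L07), the
square of Thm. 3.4 (i) (`oneCommutes_isotropification_of_restricts`), `rigid_of` (row C54/L08) fed by
`isDivSlim_ofFunctor_rlf`, and `IsRigidFunctor.leftAdjoint_comp` along `C₁ → C₁^istr`.
[cite: MochizukiFrdI2008, Cor. 5.4 p.104] -/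
theorem printedDiagram_of_restricts (hF₁ : PreFrobenioid.IsFrobenioid F₁) (hF₂ : PreFrobenioid.IsFrobenioid F₂)
    (hq₁ : (ofFunctor Φ₁ F₁).IsOfQuasiIsotropicType) (hq₂ : (ofFunctor Φ₂ F₂).IsOfQuasiIsotropicType)
    (Ψ : C₁ ≌ C₂)
    (Ψistr : (ofFunctor Φ₁ F₁).Istr ⥤ (ofFunctor Φ₂ F₂).Istr)
    (hΨistr : Ψistr ⋙ (ofFunctor Φ₂ F₂).istrι ≅ (ofFunctor Φ₁ F₁).istrι ⋙ Ψ.functor)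
    (Ψuntr : (ofFunctor Φ₁ F₁).Untr ⥤ (ofFunctor Φ₂ F₂).Untr)
    (s : Ψistr ⋙ (ofFunctor Φ₂ F₂).toUntr ≅ (ofFunctor Φ₁ F₁).toUntr ⋙ Ψuntr)
    (ΨBase : D₁ ⥤ D₂) [ΨBase.IsEquivalence]
    (E : PreFrobenioidData.DivisorMonoidIsoOverBase (ofFunctor Φ₁ F₁) (ofFunctor Φ₂ F₂) ΨBase)
    (η : Ψ.functor ⋙ (ofFunctor Φ₂ F₂).base ≅ (ofFunctor Φ₁ F₁).base ⋙ ΨBase)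
    (hdeg : ∀ ⦃A B : C₁⦄ (φ : A ⟶ B), (ofFunctor Φ₂ F₂).degFr (Ψ.functor.map φ) = (ofFunctor Φ₁ F₁).degFr φ)
    (hdiv : ∀ ⦃A B : C₁⦄ (φ : A ⟶ B),
      (ofFunctor Φ₂ F₂).div (Ψ.functor.map φ) =
        (ofFunctor Φ₂ F₂).pull (η.hom.app A) (E.iso ((ofFunctor Φ₁ F₁).base.obj A) ((ofFunctor Φ₁ F₁).div φ)))
    (hbirat : BiratCompat F₁ F₂ ΨBase E) :
    ∃ Ψrlf : PreFrobenioid.rlf F₁ hΦ₁ ⥤ PreFrobenioid.rlf F₂ hΦ₂,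
      Ψrlf.IsEquivalence ∧
        IsInducedBy F₁ hΦ₁ F₂ hΦ₂ ΨBase (rlfIso F₁ hΦ₁ F₂ hΦ₂ E) Ψrlf ∧
          OneCommutes Ψ.functor
            ((PreFrobenioid.isotropification hF₂ ⋙
                ObjectProperty.ιOfLE (PreFrobenioid.isotropicObjects_le_ofFunctor F₂)) ⋙
              FrdI.Prop53Sub.iotaRlf F₂ hΦ₂ (PreFrobenioid.untrComparison F₂ hF₂))
            ((PreFrobenioid.isotropification hF₁ ⋙
                ObjectProperty.ιOfLE (PreFrobenioid.isotropicObjects_le_ofFunctor F₁)) ⋙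
              FrdI.Prop53Sub.iotaRlf F₁ hΦ₁ (PreFrobenioid.untrComparison F₁ hF₁))
            Ψrlf ∧
          ((ofFunctor Φ₁ F₁).IsDivSlim → (ofFunctor Φ₂ F₂).IsDivSlim →
            IsRigidFunctor
                (((PreFrobenioid.isotropification hF₁ ⋙
                    ObjectProperty.ιOfLE (PreFrobenioid.isotropicObjects_le_ofFunctor F₁)) ⋙
                  FrdI.Prop53Sub.iotaRlf F₁ hΦ₁ (PreFrobenioid.untrComparison F₁ hF₁)) ⋙ Ψrlf) ∧
              IsRigidFunctor
                (Ψ.functor ⋙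
                  ((PreFrobenioid.isotropification hF₂ ⋙
                      ObjectProperty.ιOfLE (PreFrobenioid.isotropicObjects_le_ofFunctor F₂)) ⋙
                    FrdI.Prop53Sub.iotaRlf F₂ hΦ₂ (PreFrobenioid.untrComparison F₂ hF₂)))) ∧
          ∀ Ψrlf' : PreFrobenioid.rlf F₁ hΦ₁ ⥤ PreFrobenioid.rlf F₂ hΦ₂,
            IsInducedBy F₁ hΦ₁ F₂ hΦ₂ ΨBase (rlfIso F₁ hΦ₁ F₂ hΦ₂ E) Ψrlf' → Nonempty (Ψrlf ≅ Ψrlf') := by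
  obtain ⟨Ψrlf, hequiv, hind, hsq, huniq⟩ := exists_rlfTransport_square' F₁ hΦ₁ F₂ hΦ₂ hF₁ hF₂ Ψ.functor Ψistr
    hΨistr Ψuntr s ΨBase E η hdeg hdiv hbirat
  -- the square of Thm. 3.4 (i) on top of the square of row C54/L06
  have htop := oneCommutes_isotropification_of_restricts hF₁ hF₂ hq₁ hq₂ Ψ Ψistr hΨistr
  have hbot : OneCommutes Ψistr (FrdI.Prop53Sub.iotaRlf F₂ hΦ₂ (PreFrobenioid.untrComparison F₂ hF₂))
      (FrdI.Prop53Sub.iotaRlf F₁ hΦ₁ (PreFrobenioid.untrComparison F₁ hF₁)) Ψrlf :=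
    ⟨hsq.some.symm⟩
  have hpaste := htop.vcomp hbot
  refine ⟨Ψrlf, hequiv, hind, hpaste, fun hD₁ hD₂ => ?_, huniq⟩
  -- rigidity: Div-slim w.r.t. `Φ_i` ⇒ Div-slim w.r.t. `Φ_i^rlf` (seat abc-iut-L1-d2), row C54/L08 for the
  -- equivalence `Ψ^istr`, then precomposition with the reflector `C₁ → C₁^istr`
  haveI : Ψistr.IsEquivalence := isEquivalence_of_restricts hF₁ hF₂ hq₁ hq₂ Ψ Ψistr hΨistr
  have hD₁' : (rlfData F₁ hΦ₁).IsDivSlim :=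
    isDivSlim_ofFunctor_rlf Φ₁ F₁ (PreFrobenioid.IsPerfFactorialOn.op hΦ₁) (PreFrobenioid.rlfToElem F₁ hΦ₁) hD₁
  have hD₂' : (rlfData F₂ hΦ₂).IsDivSlim :=
    isDivSlim_ofFunctor_rlf Φ₂ F₂ (PreFrobenioid.IsPerfFactorialOn.op hΦ₂) (PreFrobenioid.rlfToElem F₂ hΦ₂) hD₂
  obtain ⟨hr₁, hr₂⟩ := rigid_of hΦ₁ hΦ₂ Ψistr (PreFrobenioid.untrComparison F₁ hF₁)
    (PreFrobenioid.untrComparison F₂ hF₂) Ψrlf hD₁' hD₂' hsq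
  -- the comparison `Istr F₁ ⥤ (ofFunctor Φ₁ F₁).Istr` is an equivalence (propositionally equal object properties)
  haveI : (ObjectProperty.ιOfLE (PreFrobenioid.isotropicObjects_le_ofFunctor F₁)).IsEquivalence :=
    (ObjectProperty.isEquivalence_ιOfLE_iff _).2
      (le_trans (PreFrobenioid.isotropicObjects_ofFunctor_le F₁) (ObjectProperty.le_isoClosure _))
  have key : ∀ {G : (ofFunctor Φ₁ F₁).Istr ⥤ PreFrobenioid.rlf F₂ hΦ₂}, IsRigidFunctor G →
      IsRigidFunctor ((PreFrobenioid.isotropification hF₁ ⋙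
        ObjectProperty.ιOfLE (PreFrobenioid.isotropicObjects_le_ofFunctor F₁)) ⋙ G) := fun {G} hG =>
    IsRigidFunctor.leftAdjoint_comp (PreFrobenioid.isotropificationAdjunction hF₁)
      (IsRigidFunctor.comp_of_isEquivalence
        (ObjectProperty.ιOfLE (PreFrobenioid.isotropicObjects_le_ofFunctor F₁)) hG)
  refine ⟨key hr₁, ?_⟩
  -- second composite: `Ψ ⋙ (C₂ → C₂^istr → C₂^rlf) ≅ (C₁ → C₁^istr) ⋙ (Ψ^istr ⋙ ι₂)`
  have htop' := htop.postcomp (FrdI.Prop53Sub.iotaRlf F₂ hΦ₂ (PreFrobenioid.untrComparison F₂ hF₂))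
  exact (key hr₂).of_iso htop'.some.symm

/-- **[FrdI] Cor. 5.4, THE PRINTED DIAGRAM, the `Φ^birat`-compatibility discharged** ("follows immediately from
Corollaries 4.10; 4.11, (iii), (iv)"): as `printedDiagram_of_restricts`, with the binder `BiratCompat` replaced
by its source — `Ψ`, `Ψ⁻¹` preserve pre-steps and co-angular pre-steps (conclusion shape of Thm. 3.4 (ii)),
via seat abc-iut-w5-d221's `biratCompat_of`. [cite: MochizukiFrdI2008, Cor. 5.4 p.104] -/
theorem printedDiagram_of_preservesPreSteps (hF₁ : PreFrobenioid.IsFrobenioid F₁)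
    (hF₂ : PreFrobenioid.IsFrobenioid F₂)
    (hq₁ : (ofFunctor Φ₁ F₁).IsOfQuasiIsotropicType) (hq₂ : (ofFunctor Φ₂ F₂).IsOfQuasiIsotropicType)
    (Ψ : C₁ ≌ C₂)
    (Ψistr : (ofFunctor Φ₁ F₁).Istr ⥤ (ofFunctor Φ₂ F₂).Istr)
    (hΨistr : Ψistr ⋙ (ofFunctor Φ₂ F₂).istrι ≅ (ofFunctor Φ₁ F₁).istrι ⋙ Ψ.functor)
    (Ψuntr : (ofFunctor Φ₁ F₁).Untr ⥤ (ofFunctor Φ₂ F₂).Untr)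
    (s : Ψistr ⋙ (ofFunctor Φ₂ F₂).toUntr ≅ (ofFunctor Φ₁ F₁).toUntr ⋙ Ψuntr)
    (ΨBase : D₁ ⥤ D₂) [ΨBase.IsEquivalence]
    (E : PreFrobenioidData.DivisorMonoidIsoOverBase (ofFunctor Φ₁ F₁) (ofFunctor Φ₂ F₂) ΨBase)
    (η : Ψ.functor ⋙ (ofFunctor Φ₂ F₂).base ≅ (ofFunctor Φ₁ F₁).base ⋙ ΨBase)
    (hdeg : ∀ ⦃A B : C₁⦄ (φ : A ⟶ B), (ofFunctor Φ₂ F₂).degFr (Ψ.functor.map φ) = (ofFunctor Φ₁ F₁).degFr φ)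
    (hdiv : ∀ ⦃A B : C₁⦄ (φ : A ⟶ B),
      (ofFunctor Φ₂ F₂).div (Ψ.functor.map φ) =
        (ofFunctor Φ₂ F₂).pull (η.hom.app A) (E.iso ((ofFunctor Φ₁ F₁).base.obj A) ((ofFunctor Φ₁ F₁).div φ)))
    (hpre : PreFrobenioidData.PreservesMor Ψ.functor (ofFunctor Φ₁ F₁).IsPreStep (ofFunctor Φ₂ F₂).IsPreStep)
    (hco : PreFrobenioidData.PreservesMor Ψ.functor (ofFunctor Φ₁ F₁).IsCoAngularPreStep
      (ofFunctor Φ₂ F₂).IsCoAngularPreStep)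
    (hpre' : PreFrobenioidData.PreservesMor Ψ.inverse (ofFunctor Φ₂ F₂).IsPreStep (ofFunctor Φ₁ F₁).IsPreStep)
    (hco' : PreFrobenioidData.PreservesMor Ψ.inverse (ofFunctor Φ₂ F₂).IsCoAngularPreStep
      (ofFunctor Φ₁ F₁).IsCoAngularPreStep) :
    ∃ Ψrlf : PreFrobenioid.rlf F₁ hΦ₁ ⥤ PreFrobenioid.rlf F₂ hΦ₂,
      Ψrlf.IsEquivalence ∧
        IsInducedBy F₁ hΦ₁ F₂ hΦ₂ ΨBase (rlfIso F₁ hΦ₁ F₂ hΦ₂ E) Ψrlf ∧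
          OneCommutes Ψ.functor
            ((PreFrobenioid.isotropification hF₂ ⋙
                ObjectProperty.ιOfLE (PreFrobenioid.isotropicObjects_le_ofFunctor F₂)) ⋙
              FrdI.Prop53Sub.iotaRlf F₂ hΦ₂ (PreFrobenioid.untrComparison F₂ hF₂))
            ((PreFrobenioid.isotropification hF₁ ⋙
                ObjectProperty.ιOfLE (PreFrobenioid.isotropicObjects_le_ofFunctor F₁)) ⋙
              FrdI.Prop53Sub.iotaRlf F₁ hΦ₁ (PreFrobenioid.untrComparison F₁ hF₁))
            Ψrlf ∧
          ((ofFunctor Φ₁ F₁).IsDivSlim → (ofFunctor Φ₂ F₂).IsDivSlim →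
            IsRigidFunctor
                (((PreFrobenioid.isotropification hF₁ ⋙
                    ObjectProperty.ιOfLE (PreFrobenioid.isotropicObjects_le_ofFunctor F₁)) ⋙
                  FrdI.Prop53Sub.iotaRlf F₁ hΦ₁ (PreFrobenioid.untrComparison F₁ hF₁)) ⋙ Ψrlf) ∧
              IsRigidFunctor
                (Ψ.functor ⋙
                  ((PreFrobenioid.isotropification hF₂ ⋙
                      ObjectProperty.ιOfLE (PreFrobenioid.isotropicObjects_le_ofFunctor F₂)) ⋙
                    FrdI.Prop53Sub.iotaRlf F₂ hΦ₂ (PreFrobenioid.untrComparison F₂ hF₂)))) ∧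
          ∀ Ψrlf' : PreFrobenioid.rlf F₁ hΦ₁ ⥤ PreFrobenioid.rlf F₂ hΦ₂,
            IsInducedBy F₁ hΦ₁ F₂ hΦ₂ ΨBase (rlfIso F₁ hΦ₁ F₂ hΦ₂ E) Ψrlf' → Nonempty (Ψrlf ≅ Ψrlf') :=
  printedDiagram_of_restricts F₁ F₂ hΦ₁ hΦ₂ hF₁ hF₂ hq₁ hq₂ Ψ Ψistr hΨistr Ψuntr s ΨBase E η hdeg hdiv
    (biratCompat_of F₁ F₂ Ψ hF₂.isPreFrobenioid ΨBase E η hdiv hpre hco hpre' hco')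

/-- **[FrdI] Cor. 5.4, THE PRINTED DIAGRAM at THE `Ψ^istr`** — the restriction
`Ψ.congrFullSubcategory _` of `Ψ` to the isotropic objects (Thm. 3.4 (i)), for which the restriction datum
`hΨistr` is the identity: as `printedDiagram_of_restricts` with no `Ψ^istr` binder, `Ψ^un-tr` and its square of
Cor. 4.11 (i) being taken over THE `Ψ^istr`. [cite: MochizukiFrdI2008, Cor. 5.4 p.104] -/
theorem printedDiagram_restriction (hF₁ : PreFrobenioid.IsFrobenioid F₁) (hF₂ : PreFrobenioid.IsFrobenioid F₂)
    (hq₁ : (ofFunctor Φ₁ F₁).IsOfQuasiIsotropicType) (hq₂ : (ofFunctor Φ₂ F₂).IsOfQuasiIsotropicType)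
    (Ψ : C₁ ≌ C₂) [(ofFunctor Φ₂ F₂).isotropicObjects.IsClosedUnderIsomorphisms]
    (Ψuntr : (ofFunctor Φ₁ F₁).Untr ⥤ (ofFunctor Φ₂ F₂).Untr)
    (s : (Ψ.congrFullSubcategory (isotropicObjects_ofFunctor_inverseImage hF₁ hq₁ hq₂ Ψ)).functor ⋙
        (ofFunctor Φ₂ F₂).toUntr ≅ (ofFunctor Φ₁ F₁).toUntr ⋙ Ψuntr)
    (ΨBase : D₁ ⥤ D₂) [ΨBase.IsEquivalence]
    (E : PreFrobenioidData.DivisorMonoidIsoOverBase (ofFunctor Φ₁ F₁) (ofFunctor Φ₂ F₂) ΨBase)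
    (η : Ψ.functor ⋙ (ofFunctor Φ₂ F₂).base ≅ (ofFunctor Φ₁ F₁).base ⋙ ΨBase)
    (hdeg : ∀ ⦃A B : C₁⦄ (φ : A ⟶ B), (ofFunctor Φ₂ F₂).degFr (Ψ.functor.map φ) = (ofFunctor Φ₁ F₁).degFr φ)
    (hdiv : ∀ ⦃A B : C₁⦄ (φ : A ⟶ B),
      (ofFunctor Φ₂ F₂).div (Ψ.functor.map φ) =
        (ofFunctor Φ₂ F₂).pull (η.hom.app A) (E.iso ((ofFunctor Φ₁ F₁).base.obj A) ((ofFunctor Φ₁ F₁).div φ)))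
    (hbirat : BiratCompat F₁ F₂ ΨBase E) :
    ∃ Ψrlf : PreFrobenioid.rlf F₁ hΦ₁ ⥤ PreFrobenioid.rlf F₂ hΦ₂,
      Ψrlf.IsEquivalence ∧
        IsInducedBy F₁ hΦ₁ F₂ hΦ₂ ΨBase (rlfIso F₁ hΦ₁ F₂ hΦ₂ E) Ψrlf ∧
          OneCommutes Ψ.functor
            ((PreFrobenioid.isotropification hF₂ ⋙
                ObjectProperty.ιOfLE (PreFrobenioid.isotropicObjects_le_ofFunctor F₂)) ⋙
              FrdI.Prop53Sub.iotaRlf F₂ hΦ₂ (PreFrobenioid.untrComparison F₂ hF₂))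
            ((PreFrobenioid.isotropification hF₁ ⋙
                ObjectProperty.ιOfLE (PreFrobenioid.isotropicObjects_le_ofFunctor F₁)) ⋙
              FrdI.Prop53Sub.iotaRlf F₁ hΦ₁ (PreFrobenioid.untrComparison F₁ hF₁))
            Ψrlf ∧
          ((ofFunctor Φ₁ F₁).IsDivSlim → (ofFunctor Φ₂ F₂).IsDivSlim →
            IsRigidFunctor
                (((PreFrobenioid.isotropification hF₁ ⋙
                    ObjectProperty.ιOfLE (PreFrobenioid.isotropicObjects_le_ofFunctor F₁)) ⋙
                  FrdI.Prop53Sub.iotaRlf F₁ hΦ₁ (PreFrobenioid.untrComparison F₁ hF₁)) ⋙ Ψrlf) ∧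
              IsRigidFunctor
                (Ψ.functor ⋙
                  ((PreFrobenioid.isotropification hF₂ ⋙
                      ObjectProperty.ιOfLE (PreFrobenioid.isotropicObjects_le_ofFunctor F₂)) ⋙
                    FrdI.Prop53Sub.iotaRlf F₂ hΦ₂ (PreFrobenioid.untrComparison F₂ hF₂)))) ∧
          ∀ Ψrlf' : PreFrobenioid.rlf F₁ hΦ₁ ⥤ PreFrobenioid.rlf F₂ hΦ₂,
            IsInducedBy F₁ hΦ₁ F₂ hΦ₂ ΨBase (rlfIso F₁ hΦ₁ F₂ hΦ₂ E) Ψrlf' → Nonempty (Ψrlf ≅ Ψrlf') :=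
  printedDiagram_of_restricts F₁ F₂ hΦ₁ hΦ₂ hF₁ hF₂ hq₁ hq₂ Ψ
    (Ψ.congrFullSubcategory (isotropicObjects_ofFunctor_inverseImage hF₁ hq₁ hq₂ Ψ)).functor (Iso.refl _)
    Ψuntr s ΨBase E η hdeg hdiv hbirat

end FrdI.Cor54Sub

end Literature.AlgebraicGeometry.Frobenioids
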